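import Summits.BirchSwinnertonDyer.BirchSwinnertonDyer.Theorems.EisensteinPrimesBSDpOnCellCTelescopeK2SelmerCofinite
import Summits.BirchSwinnertonDyer.BirchSwinnertonDyer.Theorems.EisensteinPrimesTwoVariableSelmerControl
import Literature.NumberTheory.EllipticCurves.AnticyclotomicBigGaloisRep
import Literature.NumberTheory.GaloisRepresentations.GaloisRep
import HarnessLib

/-!
# Crux 4 `BSDpOnCellC` (stmt-BirchSwinnertonDyer-19034), line «telescope» v8, leaf N2 `stub_weightTwoControl`,
# conjunct (fg) / memo W1: the big anticyclotomic module `M₂ = A ⊗ Λ^*(Ψ⁻¹)` is a `G_{K,S}`-module for every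
# `S ⊇ S₀ ∪ {w ∣ p}` when `ρ` is unramified outside `S₀` (helper; closes nothing)

Route `EisensteinPrimes`, crux `BSDpOnCellC`; ideator seat `bsd-idea-12` (gen 36), `--supports
stmt-BirchSwinnertonDyer-19034 --as helper`. THEOREMS only; no `def`, no instance, no named fact, no `sorry`.
HONEST FRAMING: bookkeeping; proves no crux, no registered stub, no summit statement; BSD is proved for no
curve here.

WHAT AND WHY. The registered skeleton `Cruxes/BSDpOnCellC/Lines/telescope.lean` (v8) hands the leaf
`stub_weightTwoControl` the hypothesis `∃ S₀, S₀.Finite ∧ GaloisRep.IsUnramifiedOutside S₀ ρ₂` on the Hida-type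
family `ρ₂ : ContinuousRep Γ_K ℤ_p⟦X⟧ A₂` and asks, as conjunct (fg), for
`Module.Finite ℤ_p⟦X⟧⟦T⟧ (XBig κ ρ₂ 𝔭bar ∅)`.  The landed reductions of (fg) — the descent
`TelescopeK2RepDescent.descendUnramified` (p746306) and the Selmer dictionary
`TelescopeK2SelmerDictionary.selmerEquivOfKer` (p747353) — are stated under the hypothesis
`ramificationSubgroup K S ≤ (AnticyclotomicBigGaloisRep κ ρ₂).ker` for a FINITE `S`.  This file derives that
hypothesis from the v8 datum: the big representation `bigRep κ ρ` (`(g · Φ)(x) = ρ(g)(Φ(x - κ g))`,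
`bigRep_apply_apply`) is trivial on `ker ρ ⊓ ker κ` (§1); Greenberg's inertia group `I_w`
(`GreenbergSelmer.inertia w`) lies in `ker ρ` for `w ∉ S₀` (Serre's `IsUnramifiedOutside`, bridged to `I_w` by
`inertia_adicCompletionPrime_eq_map_absInertia`, Neukirch II (9.6)) and in `ker κ` for `w ∤ p` (every
`ℤ_p`-extension is unramified outside `p`: the tree's THEOREM `IwasawaTwoVariable.inertia_le_kerSubgroup_of_not_mem`
← `ZpExtension.inertia_le_kerSubgroup_holds`, Washington Prop. 13.2) (§2); hence
`N_S ≤ ker (AnticyclotomicBigGaloisRep κ ρ)` for every `S` with `S₀ ∪ {w ∣ p} ⊆ S`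
(`TelescopeK2RepDescent.ramificationSubgroup_le_ker_of_forall_inertia`, p746306), and the finite choice
`S = S₀ ∪ Σ ∪ {w ∣ p}` (§3, `Ideal.finite_factors`).  §4 feeds this into the landed cofinite-generation
reduction `TelescopeK2SelmerCofinite.module_finite_XBig` (Greenberg 2006 Prop. 3.2 on `G_{K,S}` + the Selmer
dictionary): conjunct (fg) of `stub_weightTwoControl`, with the v8 hypothesis
`∃ S₀, S₀.Finite ∧ GaloisRep.IsUnramifiedOutside S₀ ρ₂` consumed as stated, now rests on ONE displayed
construction-node input — the cofinite generation of `BigRepModule ℤ_p⟦X⟧ p A₂` over `ℤ_p⟦X⟧⟦T⟧`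
(`module_finite_XBig_twoVar_of_isUnramifiedOutside`).

References: [Castella2018] §2.1 (the action `ρ ⊗ Ψ⁻¹` on `𝒜 = T ⊗ Λ^*`); [Washington1997] Prop. 13.2;
[NeukirchANT1999] II (9.6); [Greenberg2006] p. 341 L6–10 (`Gal(K_Σ/K)`-modules, `Σ ⊇ {p, ∞} ∪ Ram(D)`).

## References
[cite: Castella2018, §2.1] [cite: Washington1997, Prop. 13.2] [cite: NeukirchANT1999, Ch. II §9 Prop. (9.6)]
[cite: Greenberg2006, p. 341 L6–10]
-/

set_option linter.dupNamespace false
set_option autoImplicit false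

open Field IsDedekindDomain NumberField Topology
open Literature.NumberTheory.GaloisRepresentations Literature.NumberTheory.EllipticCurves
open Literature.NumberTheory.IwasawaTheory
open scoped NumberField

universe u

namespace Summit.BirchSwinnertonDyer.BirchSwinnertonDyer.Theorems.TelescopeK2BigRepUnramified

/-! ## §1. `ker ρ ⊓ ker κ` acts trivially on the big module `A ⊗ Λ^*(Ψ⁻¹)` -/

section Generic

variable {𝒪 : Type*} [CommRing 𝒪] [TopologicalSpace 𝒪] {p : ℕ} [Fact p.Prime]
  {G : Type*} [Group G] [TopologicalSpace G] [ContinuousMul G]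
  {A : Type*} [AddCommGroup A] [Module 𝒪 A] [TopologicalSpace A] [DiscreteTopology A]
  [TopologicalSpace (PowerSeries 𝒪)]

/-- If `ρ g = 1` and `κ g = 1` then `g` fixes every smooth function: `(g · Φ)(x) = ρ(g)(Φ(x - κ g)) = Φ(x)`.
[cite: Castella2018, §2.1 (G_K-action ρ ⊗ Ψ^{-1} on 𝒜)] -/
theorem bigRep_apply_eq_self (κ : G →ₜ* Multiplicative ℤ_[p]) (ρ : ContinuousRep G 𝒪 A) {g : G}
    (hρ : ρ g = LinearMap.id) (hκ : κ g = 1) (Φ : BigRepModule 𝒪 p A) : bigRep κ ρ g Φ = Φ := by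
  ext x
  rw [bigRep_apply_apply, hκ, toAdd_one, sub_zero, hρ, LinearMap.id_apply]

/-- `ker ρ ⊓ ker κ ≤ ker (bigRep κ ρ)`, elementwise. [cite: Castella2018, §2.1 (G_K-action ρ ⊗ Ψ^{-1} on 𝒜)] -/
theorem mem_ker_bigRep (κ : G →ₜ* Multiplicative ℤ_[p]) (ρ : ContinuousRep G 𝒪 A) {g : G}
    (hρ : g ∈ ρ.ker) (hκ : κ g = 1) : g ∈ (bigRep κ ρ).ker := by
  rw [ContinuousRep.mem_ker] at hρ ⊢
  exact LinearMap.ext fun Φ ↦ bigRep_apply_eq_self κ ρ hρ hκ Φ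

/-- `ker ρ ⊓ ker κ ≤ ker (bigRep κ ρ)`. [cite: Castella2018, §2.1 (G_K-action ρ ⊗ Ψ^{-1} on 𝒜)] -/
theorem ker_inf_ker_le_ker_bigRep (κ : G →ₜ* Multiplicative ℤ_[p]) (ρ : ContinuousRep G 𝒪 A) :
    ρ.ker ⊓ κ.toMonoidHom.ker ≤ (bigRep κ ρ).ker :=
  fun _ hg ↦ mem_ker_bigRep κ ρ hg.1 hg.2

end Generic

/-! ## §2. Inertia outside `S₀ ∪ {w ∣ p}` acts trivially on `AnticyclotomicBigGaloisRep κ ρ` -/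

section Arithmetic

variable {K : Type u} [Field K] [NumberField K] {p : ℕ} [Fact p.Prime]
  {𝒪 : Type*} [CommRing 𝒪] [TopologicalSpace 𝒪]
  {A : Type*} [AddCommGroup A] [Module 𝒪 A] [TopologicalSpace A] [DiscreteTopology A]

omit [DiscreteTopology A] in
/-- Serre's "unramified outside `S₀`" (`GaloisRep.IsUnramifiedOutside`: every `I_𝔓`, `𝔓 ∣ w`, acts trivially)
puts Greenberg's inertia group `I_w = res(I(K̄_w/K_w)) = I_{𝔓₀}` (`𝔓₀ = adicCompletionPrime K w`,
Neukirch II (9.6)) inside `ker ρ` for every `w ∉ S₀`.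
[cite: NeukirchANT1999, Ch. II §9 Prop. (9.6)] -/
theorem inertia_le_ker_of_isUnramifiedOutside (ρ : ContinuousRep (absoluteGaloisGroup K) 𝒪 A)
    {S₀ : Set (HeightOneSpectrum (𝓞 K))} (h : GaloisRep.IsUnramifiedOutside S₀ ρ)
    {w : HeightOneSpectrum (𝓞 K)} (hw : w ∉ S₀) : GreenbergSelmer.inertia w ≤ ρ.ker := by
  intro x hx
  obtain ⟨σ, hσ, rfl⟩ := hx
  have hτ : absGaloisRestrict K (w.adicCompletion K) σ ∈
      (adicCompletionPrime K w).inertia (absoluteGaloisGroup K) := by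
    rw [inertia_adicCompletionPrime_eq_map_absInertia]
    exact Subgroup.mem_map_of_mem _ hσ
  rw [ContinuousRep.mem_ker]
  exact h w hw _ (adicCompletionPrime_mem_primesAbove K w) _ hτ

/-- **`I_w ≤ ker (A ⊗ Λ^*(Ψ⁻¹))` for `w ∉ S₀`, `w ∤ p`**: `I_w ≤ ker ρ` (§2, `ρ` unramified outside `S₀`)
and `I_w ≤ ker κ` (every `ℤ_p`-extension of `K` is unramified outside `p`, Washington Prop. 13.2:
`IwasawaTwoVariable.inertia_le_kerSubgroup_of_not_mem`), then §1.
[cite: Washington1997, Prop. 13.2] [cite: Castella2018, §2.1 (G_K-action ρ ⊗ Ψ^{-1} on 𝒜)] -/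
theorem inertia_le_ker_anticyclotomicBigGaloisRep [TopologicalSpace (PowerSeries 𝒪)] (κ : ZpExtension K p)
    (ρ : ContinuousRep (absoluteGaloisGroup K) 𝒪 A) {S₀ : Set (HeightOneSpectrum (𝓞 K))}
    (h : GaloisRep.IsUnramifiedOutside S₀ ρ) {w : HeightOneSpectrum (𝓞 K)} (hw : w ∉ S₀)
    (hwp : ((p : ℕ) : 𝓞 K) ∉ w.asIdeal) :
    GreenbergSelmer.inertia w ≤ (AnticyclotomicBigGaloisRep κ ρ).ker := by
  intro g hg
  refine mem_ker_bigRep κ.toContinuousMonoidHom ρ (inertia_le_ker_of_isUnramifiedOutside ρ h hw hg) ?_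
  exact ZpExtension.mem_kerSubgroup.1 (IwasawaTwoVariable.inertia_le_kerSubgroup_of_not_mem κ hwp hg)

/-- **`N_S ≤ ker (A ⊗ Λ^*(Ψ⁻¹))` whenever `S ⊇ S₀ ∪ {w ∣ p}`** — the hypothesis `hker` of
`TelescopeK2SelmerDictionary.selmerEquivOfKer` / `TelescopeK2RepDescent.descendUnramified` for the big
anticyclotomic representation, from the v8 datum "`ρ` unramified outside `S₀`" (the ramification subgroup is the
closed normal closure of the `I_w`, `w ∉ S`: `TelescopeK2RepDescent.ramificationSubgroup_le_ker_of_forall_inertia`).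
[cite: Greenberg2006, p. 341 L6–10] [cite: Washington1997, Prop. 13.2] -/
theorem ramificationSubgroup_le_ker_anticyclotomicBigGaloisRep [TopologicalSpace (PowerSeries 𝒪)]
    (κ : ZpExtension K p) (ρ : ContinuousRep (absoluteGaloisGroup K) 𝒪 A)
    {S₀ : Set (HeightOneSpectrum (𝓞 K))} (h : GaloisRep.IsUnramifiedOutside S₀ ρ)
    (S : Set (HeightOneSpectrum (𝓞 K)))
    (hS : ∀ w : HeightOneSpectrum (𝓞 K), w ∉ S → w ∉ S₀ ∧ ((p : ℕ) : 𝓞 K) ∉ w.asIdeal) :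
    ramificationSubgroup K S ≤ (AnticyclotomicBigGaloisRep κ ρ).ker :=
  TelescopeK2RepDescent.ramificationSubgroup_le_ker_of_forall_inertia S (AnticyclotomicBigGaloisRep κ ρ)
    fun w hw ↦ inertia_le_ker_anticyclotomicBigGaloisRep κ ρ h (hS w hw).1 (hS w hw).2

/-! ## §3. The finite set `S = S₀ ∪ Σ ∪ {w ∣ p}` -/

omit [Fact (Nat.Prime p)] in
/-- The primes of `𝓞 K` above `p` form a finite set (`(p) ≠ 0` has finitely many prime factors).
[cite: NeukirchANT1999, Ch. I §3 Thm. (3.3)] -/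
theorem finite_setOf_natCast_mem (hK : ((p : ℕ) : 𝓞 K) ≠ 0) :
    {w : HeightOneSpectrum (𝓞 K) | ((p : ℕ) : 𝓞 K) ∈ w.asIdeal}.Finite :=
  (Ideal.finite_factors ((Ideal.span_singleton_eq_bot.not).2 hK)).subset
    fun _ hv ↦ Ideal.dvd_span_singleton.2 hv

/-- **The finite ramification set of the K2 line.**  For `ρ` unramified outside a finite `S₀` and a finite
auxiliary set `Σ` (the places where the strict condition is imposed; `Σ = ∅` in v8), the set
`S = S₀ ∪ Σ ∪ {w ∣ p}` is finite, contains `Σ` and the primes above `p` in the form the landed dictionary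
wants (`∀ w ∉ S, w ∉ Σ ∧ p ∉ w`), and `N_S ≤ ker (AnticyclotomicBigGaloisRep κ ρ)`.
[cite: Greenberg2006, p. 341 L6–10] [cite: Washington1997, Prop. 13.2] -/
theorem exists_finite_ramificationSubgroup_le_ker [TopologicalSpace (PowerSeries 𝒪)]
    (κ : ZpExtension K p) (ρ : ContinuousRep (absoluteGaloisGroup K) 𝒪 A)
    {S₀ : Set (HeightOneSpectrum (𝓞 K))} (hS₀ : S₀.Finite) (h : GaloisRep.IsUnramifiedOutside S₀ ρ)
    (Sig : Set (HeightOneSpectrum (𝓞 K))) (hSig : Sig.Finite) :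
    ∃ S : Set (HeightOneSpectrum (𝓞 K)), S.Finite ∧
      (∀ w : HeightOneSpectrum (𝓞 K), w ∉ S → w ∉ Sig ∧ ((p : ℕ) : 𝓞 K) ∉ w.asIdeal) ∧
      (∀ w : HeightOneSpectrum (𝓞 K), ((p : ℕ) : 𝓞 K) ∈ w.asIdeal → w ∈ S) ∧
      ramificationSubgroup K S ≤ (AnticyclotomicBigGaloisRep κ ρ).ker := by
  have hp0 : ((p : ℕ) : 𝓞 K) ≠ 0 := Nat.cast_ne_zero.2 (Fact.out : p.Prime).ne_zero
  refine ⟨S₀ ∪ Sig ∪ {w | ((p : ℕ) : 𝓞 K) ∈ w.asIdeal},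
    (hS₀.union hSig).union (finite_setOf_natCast_mem hp0), fun w hw ↦ ⟨fun h' ↦ hw (Or.inl (Or.inr h')),
      fun h' ↦ hw (Or.inr h')⟩, fun w hw ↦ Or.inr hw, ?_⟩
  exact ramificationSubgroup_le_ker_anticyclotomicBigGaloisRep κ ρ h _
    fun w hw ↦ ⟨fun h' ↦ hw (Or.inl (Or.inl h')), fun h' ↦ hw (Or.inr h')⟩

end Arithmetic

/-! ## §4. Conjunct (fg) of `stub_weightTwoControl` modulo cofinite generation of the big module -/

section K2

variable {K : Type} [Field K] [NumberField K] {p : ℕ} [Fact p.Prime]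
  {𝒪 : Type} [CommRing 𝒪] [TopologicalSpace 𝒪]
  {A : Type} [AddCommGroup A] [Module 𝒪 A] [TopologicalSpace A] [DiscreteTopology A]
  [TopologicalSpace (PowerSeries 𝒪)] [ContinuousSMul (PowerSeries 𝒪) (BigRepModule 𝒪 p A)]

/-- **`X^Σ_𝔮 = XBig κ ρ 𝔮 Σ` is a finitely generated `Λ_𝒪`-module** for `ρ` unramified outside a FINITE `S₀`
and `Σ` finite, given `Λ_𝒪 = PowerSeries 𝒪 ≃+* ℤ_p⟦T₁, …, T_m⟧` and the cofinite generation of the big module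
`A ⊗ Λ_𝒪^*` over `Λ_𝒪`: §3 supplies the finite `S ⊇ S₀ ∪ Σ ∪ {w ∣ p}` with `N_S ≤ ker`, and
`TelescopeK2SelmerCofinite.module_finite_XBig` (Greenberg 2006 Prop. 3.2 over `G_{K,S}` + inflation) concludes.
[cite: Greenberg2006, Prop. 3.2 (p. 358 L37)] [cite: Castella2018Erratum, §2 (p. 2–3, "`X^Σ_ac(A_g) = Sel^Σ_𝔭(K, M_g)^*`")] -/
theorem module_finite_XBig_of_isUnramifiedOutside {m : ℕ} (e : PowerSeries 𝒪 ≃+* MvPowerSeries (Fin m) ℤ_[p])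
    (κ : ZpExtension K p) (ρ : ContinuousRep (absoluteGaloisGroup K) 𝒪 A)
    (hD : Greenberg2006.IsCofinitelyGenerated (PowerSeries 𝒪) (BigRepModule 𝒪 p A))
    {S₀ : Set (HeightOneSpectrum (𝓞 K))} (hS₀ : S₀.Finite) (h : GaloisRep.IsUnramifiedOutside S₀ ρ)
    (𝔮 : HeightOneSpectrum (𝓞 K)) (Sig : Set (HeightOneSpectrum (𝓞 K))) (hSig : Sig.Finite) :
    Module.Finite (PowerSeries 𝒪) (BigGaloisRep.XBig κ ρ 𝔮 Sig) := by
  obtain ⟨S, hSfin, hS, -, hker⟩ := exists_finite_ramificationSubgroup_le_ker κ ρ hS₀ h Sig hSig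
  exact TelescopeK2SelmerCofinite.module_finite_XBig e κ ρ hD S hSfin hker 𝔮 Sig hS

/-- The same in Greenberg's language: `Sel^Σ_𝔮(K, A ⊗ Λ_𝒪^*)` is a cofinitely generated `Λ_𝒪`-module.
[cite: Greenberg2006, Prop. 3.2 (p. 358 L37)] -/
theorem isCofinitelyGenerated_selmerBig_of_isUnramifiedOutside {m : ℕ}
    (e : PowerSeries 𝒪 ≃+* MvPowerSeries (Fin m) ℤ_[p])
    (κ : ZpExtension K p) (ρ : ContinuousRep (absoluteGaloisGroup K) 𝒪 A)
    (hD : Greenberg2006.IsCofinitelyGenerated (PowerSeries 𝒪) (BigRepModule 𝒪 p A))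
    {S₀ : Set (HeightOneSpectrum (𝓞 K))} (hS₀ : S₀.Finite) (h : GaloisRep.IsUnramifiedOutside S₀ ρ)
    (𝔮 : HeightOneSpectrum (𝓞 K)) (Sig : Set (HeightOneSpectrum (𝓞 K))) (hSig : Sig.Finite) :
    Greenberg2006.IsCofinitelyGenerated (PowerSeries 𝒪) (BigGaloisRep.selmerBig κ ρ 𝔮 Sig) := by
  obtain ⟨S, hSfin, hS, -, hker⟩ := exists_finite_ramificationSubgroup_le_ker κ ρ hS₀ h Sig hSig
  exact TelescopeK2SelmerCofinite.isCofinitelyGenerated_selmerBig e κ ρ hD S hSfin hker 𝔮 Sig hS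

end K2

section K2TwoVar

variable {K : Type} [Field K] [NumberField K]

/-- **v8 `stub_weightTwoControl`, conjunct (fg), modulo ONE construction-node input.**  In the K2 branch
(`B = ℤ_p⟦X⟧⟦T⟧ ≃+* ℤ_p⟦T₁, T₂⟧`, `nonempty_iwasawaAlgebraTwoVar_ringEquiv_mvPowerSeries`), with the v8
hypothesis `∃ S₀, S₀.Finite ∧ GaloisRep.IsUnramifiedOutside S₀ ρ₂` consumed AS STATED in the skeleton and
`Σ = ∅`, the module `XBig κ ρ₂ 𝔭bar ∅` is finitely generated over `B` as soon as the big module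
`A₂ ⊗ B^*(Ψ⁻¹) = BigRepModule ℤ_p⟦X⟧ p A₂` is a cofinitely generated `B`-module (displayed hypothesis `hD`;
this input belongs to the construction node `stub_branchLattice`). Closes nothing by itself.
[cite: Greenberg2006, Prop. 3.2 (p. 358 L37)] [cite: Greenberg2016Selmer, §1 p. 4 L11–13] -/
theorem module_finite_XBig_twoVar_of_isUnramifiedOutside {p : ℕ} [Fact p.Prime]
    {A₂ : Type} [AddCommGroup A₂] [Module (PowerSeries ℤ_[p]) A₂] [TopologicalSpace A₂] [DiscreteTopology A₂]
    [TopologicalSpace (PowerSeries ℤ_[p])] [TopologicalSpace (PowerSeries (PowerSeries ℤ_[p]))]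
    [ContinuousSMul (PowerSeries (PowerSeries ℤ_[p])) (BigRepModule (PowerSeries ℤ_[p]) p A₂)]
    (κ : ZpExtension K p) (ρ₂ : ContinuousRep (absoluteGaloisGroup K) (PowerSeries ℤ_[p]) A₂)
    (hD : Greenberg2006.IsCofinitelyGenerated (PowerSeries (PowerSeries ℤ_[p]))
      (BigRepModule (PowerSeries ℤ_[p]) p A₂))
    (hur : ∃ S₀ : Set (HeightOneSpectrum (𝓞 K)), S₀.Finite ∧ GaloisRep.IsUnramifiedOutside S₀ ρ₂)
    (𝔭bar : HeightOneSpectrum (𝓞 K)) :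
    Module.Finite (PowerSeries (PowerSeries ℤ_[p]))
      (BigGaloisRep.XBig κ ρ₂ 𝔭bar (∅ : Set (HeightOneSpectrum (𝓞 K)))) := by
  obtain ⟨S₀, hS₀, h⟩ := hur
  exact module_finite_XBig_of_isUnramifiedOutside
    (Classical.choice (nonempty_iwasawaAlgebraTwoVar_ringEquiv_mvPowerSeries p)) κ ρ₂ hD hS₀ h 𝔭bar
    (∅ : Set (HeightOneSpectrum (𝓞 K))) Set.finite_empty

end K2TwoVar

end Summit.BirchSwinnertonDyer.BirchSwinnertonDyer.Theorems.TelescopeK2BigRepUnramified
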